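import Summits.Ventures.HodgeRepro.RouteCClauses
import Summits.Ventures.HodgeRepro.RouteCFaceC8

/-!
# The first open degree-8 rank-four face discharged by closer C5′ — end to end, from the printed clauses

Blind re-derivation cell `pub-hodge-repro`, seat `night-1`.  `RouteCClauses.routeC_closes_face` is
instantiated on the face `(Φ₀; π, π′)` of `RouteCFaceC8.lean` (sealed row `Octic.Cyclic`, representative
`(15, 17, 34)`; `B ≅ A₀³ × A₁`, `B_red = A₀ × A₁`, two primitive classes, `g = 8`, `k = 2`, `p = 8`).

**Load-bearing printed clauses for THIS face, with the parameters at which they are used** (the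
hypotheses of `faceC8_weilAlgebraic` list exactly them — nothing else of Route C is used):

| clause | used at | what the model supplies |
|---|---|---|
| BMM 2016 Cor 2 (CONDITIONAL as printed, O-R2.3) | `(p, n) = (8, 2)`: `2 ≤ 8`, `2 ∉ ]8/3, 16/3[` | `bmm_range_face` |
| DR 2015 Lemma 3.5 | the two CM types `liuType Φ₀ = {0,5,6,7}`, `liuType Φ₁ = {1,2,4,7}` | `isCMType_liuType_reps` |
| Liu 2021 Cor 4.20 | rank `n = 9 ≥ 3`, the two characters `μ₀`, `μ₁` with `Φ_{μ_k} = liuType Φ_k` | `three_le_n` |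
| Liu Def 4.5 + Shimura §8.3 | `M'_{μ_k} = E` (`Stab = ⊥`), reflex type lifted = `Φ_k` | `reflexStab_liuType_reps`, `liuType_liuType_reps` |
| R5 (Lemma W, kernel core) | `g = 2 · 4 = 8 ≤ p = 8`: `f : S′ → A₀ × A₁` generically finite | `dimBred_le_p` |
| R7 (Meng L4.1 / Tankeev Cor 1.2, codim-wise) | codimension `2` | — |
| Lemma R (S3ᴿ) | the reduced sets `U_s`, `|U_s| = 4`, Pohlmann for `(Φ₀, Φ₁)` | `isHodgeSetProd_reducedSet_face` |

The ONLY conditional input is BMM Cor 2 (the stabilisation of the twisted trace formula, BMM p0002:L7–9);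
Liu Cor 4.20 is used in its exhaustion half only (ROUTE-C §17.4: unconditional for the route's orbits).
Nothing here says anything about the status of the Hodge conjecture for CM abelian varieties, which is
NOT proved: the theorem is the implication «printed clauses ⇒ S4 for this face».
-/

open Finset
open scoped Pointwise

namespace HodgeRepro.RouteC

namespace FaceC8

variable (V : Vocab C8 cc_C8)

/-- **C5′ discharges the first open degree-8 face** from exactly these clauses: BMM Cor 2 at
`(p, n) = (8, 2)`, R7 in codimension `2`, DR Lemma 3.5, Liu Cor 4.20 at rank `9`, Liu Def 4.5 + Shimura
§8.3, R5 at `p = 8`, Lemma R and the isogeny bookkeeping — then the Weil line of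
`B = A_{Φ₀} × A_{Φ₀·σ⁵} × A_{Φ₁} × A_{Φ₀·σ²}` is algebraic. -/
theorem faceC8_weilAlgebraic
    (hbmm : V.BMM2016_Cor2 8 2) (hr7 : V.Meng2019_Lemma4_1_codim 2) (hdr : V.DR2015_Lemma3_5)
    (hliu : V.Liu2021_Cor4_20 8) (hls : V.Liu2021_Def4_5_Shimura8_3) (hr5 : V.RouteC_R5 8)
    (hR : V.RouteC_LemmaR) (hisog : V.IsogFactorMult_of_isog_pow) :
    V.WeilAlgebraic face := by
  rw [face_eq_corner]
  have H : V.Clauses 8 (Fintype.card (Fin 4) / 2) :=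
    { bmm := by simpa using hbmm
      meng := by simpa using hr7
      dr := hdr
      liu := hliu
      liuShimura := hls
      r5 := hr5
      lemmaR := hR
      isog := hisog }
  exact V.routeC_closes_face cc_C8_isComplexConj reps cls tw isCMType_reps
    (face_eq_corner ▸ sumTwo_face) cls_tw_injective injOn_cosetMap_reducedSet
    (by rw [Nat.card_eq_fintype_card]; decide) (p := 8)
    (by rw [sum_dim_simple]) (by simp) (by norm_num) H

/-- The same, from the bundle `Clauses 8 2`. -/
theorem faceC8_weilAlgebraic_of_clauses (H : V.Clauses 8 2) : V.WeilAlgebraic face :=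
  faceC8_weilAlgebraic V H.bmm H.meng H.dr H.liu H.liuShimura H.r5 H.lemmaR H.isog

end FaceC8

end HodgeRepro.RouteC
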